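import Summits.ABC.ABC.Theses.DefiniteXi
import Literature.NumberTheory.EllipticCurves.TakahashiDegreeFormulaCoprimeProofs
import Literature.NumberTheory.EllipticCurves.Isogeny
import Summits.ABC.ABC.Theorems.DefiniteXiDefiniteRTControlPrimeFreyLocal
import HarnessLib

/-!
# STUB-IDEAS companion — `stub_takahashi` · ideator k3 · generation 15 (FAMILY 3: probe the extremes)

Crux `stmt-ABC-11338` (`DefiniteXi.DefiniteRTControlPrime`), stub
`theorem stub_takahashi : takahashi2001_thm_2_3_of_coprime` (cite-tagged named fact).

Gen-15 context: k2-g11's kernel-checked certificate (`StubIdeasK2G11CruxFromTakahashi.lean`,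
re-checked by k1-g15: rc 0, 0 sorries, axioms whitelist) proves
`takahashi2001_thm_2_3_of_coprime → DefiniteRTControlPrime`, so this stub is now the SOLE leaf of
the crux; its ONLY touchpoint in that chain is l.1697,
`takahashi2001_thm_2_3_of_coprime.modularDegree_le_brandtXi_mul hT Ws M q hq hcop hNs Ps hPsmin`
(one-sided, at the conductor-minimal pivot `W⋆` of a Frey class, `M` = Frey cofactor, `q` odd).

Contents — the LATTICE OF LEAVES between the stub and the crux (extremal analysis), all typed,
with the monotone implications PROVED (trivial) and the one re-glue STATED (no `sorry` anywhere:
the re-glue is recorded as a `Prop`, its proof recipe is in the memo):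
* N1  `TakahashiDegreeLeOfCoprime` (k3-g14, verbatim) + `degreeLe_of_fact` (PROVED).
* E1  `TakahashiDegreeLeFreyPivot` — N1 restricted to exactly the instances l.1697 consumes
      (curves of conductor `N(E_{a,b}) = M q` isogenous to a Frey curve, `q` odd prime); PROVED from N1
      (`degreeLeFreyPivot_of_degreeLe`, coprimality from the landed `stub_freyLocal`).
* E2  `TakahashiDefectSubpolyFrey` — E1 with the crux's own slack `C(ε) · N^ε` (the WEAKEST
      Takahashi-shaped statement through which the k2-g11 chain still closes the crux); PROVED from E1
      (`defectSubpolyFrey_of_degreeLeFreyPivot`, `C = 1`).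
* G   `CruxOfDefectSubpolyFrey : Prop := E2 → DefiniteRTControlPrime` — the re-glue, statement only.
-/

set_option linter.dupNamespace false

namespace Summit.ABC.ABC.Cruxes.DefiniteRTControlPrime.StubIdeas3G15

open Literature.NumberTheory.EllipticCurves
open Literature.NumberTheory.EllipticCurves.ModularForms
open Literature.NumberTheory.Automorphic

/-! ## N1 — consumer-minimal leaf (k3-g14, verbatim) -/

/-- **N1.** `δ₁(Mr) ≤ ξ(E; M, r) · ord_r Δ_min(E)` for the optimal curve `E` of conductor `M r`,
`r ∥ M r`. [cite: Takahashi2001, Thm. 2.3 (p. 79)] -/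
def TakahashiDegreeLeOfCoprime : Prop :=
  ∀ (W : WeierstrassCurve ℚ) [W.IsElliptic] (M r : ℕ) [NeZero (M * r)],
    r.Prime → M.Coprime r → W.conductorNorm ℤ = M * r →
    ∀ P : ModularParametrizationData W (M * r),
      (∀ (W' : WeierstrassCurve ℚ) [W'.IsElliptic], W'.conductorNorm ℤ = M * r →
          ∀ P' : ModularParametrizationData W' (M * r),
          P'.f = P.f → P.modularDegree ≤ P'.modularDegree) →
      P.modularDegree ≤
        brandtXi M r (fun n => W.LFunction n) * (W.minimalDiscriminantNorm ℤ).factorization r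

/-- The registered stub gives N1 (tree corollary). -/
theorem degreeLe_of_fact (h : takahashi2001_thm_2_3_of_coprime) : TakahashiDegreeLeOfCoprime :=
  fun W _ M r _ hr hcop hN P hmin =>
    takahashi2001_thm_2_3_of_coprime.modularDegree_le_brandtXi_mul h W M r hr hcop hN P hmin

/-! ## E1 — N1 at exactly the instances the one-leaf chain consumes (Frey pivots) -/

/-- **E1 (extremal instance set).** N1 for curves `W` of conductor `N(E_{a,b}) = M q` that are
`ℚ`-isogenous to a Frey curve, `q` an odd prime: the only instances of Takahashi's theorem that
`deg_le_of_optimalIsogenyAt` (k2-g11 certificate, l.1664–1697) ever invokes (`W = W⋆` the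
conductor-minimal pivot, `hiso` from `isIsogenous_smul`/`isIsogenous_of_f_eq`). No coprimality binder:
`gcd(M, q) = 1` is the landed `stub_freyLocal`. [cite: Takahashi2001, Thm. 2.3 (p. 79)] -/
def TakahashiDegreeLeFreyPivot : Prop :=
  ∀ (a b : ℤ), IsCoprime a b → a * b * (a + b) ≠ 0 → ∀ (M q : ℕ) [NeZero (M * q)],
    (freyCurve a b).conductorNorm ℤ = M * q → q.Prime → q ≠ 2 →
    ∀ (W : WeierstrassCurve ℚ) [W.IsElliptic], W.conductorNorm ℤ = M * q →
      (freyCurve a b).IsIsogenous W →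
      ∀ P : ModularParametrizationData W (M * q),
        (∀ (W' : WeierstrassCurve ℚ) [W'.IsElliptic], W'.conductorNorm ℤ = M * q →
            ∀ P' : ModularParametrizationData W' (M * q),
            P'.f = P.f → P.modularDegree ≤ P'.modularDegree) →
        P.modularDegree ≤
          brandtXi M q (fun n => W.LFunction n) * (W.minimalDiscriminantNorm ℤ).factorization q

/-- N1 ⇒ E1 (pure specialisation; the coprimality is `stub_freyLocal`, p96900). -/
theorem degreeLeFreyPivot_of_degreeLe (h : TakahashiDegreeLeOfCoprime) :
    TakahashiDegreeLeFreyPivot := by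
  intro a b hab h0 M q _ hN hq hq2 W _ hNW _ P hmin
  have hqN : q ∣ (freyCurve a b).conductorNorm ℤ := by rw [hN]; exact Dvd.intro_left M rfl
  have hcop : M.Coprime q := by
    have h := Summit.ABC.ABC.Theorems.DefiniteRTControlPrime.stub_freyLocal a b hab h0 q hq hq2 hqN
    rwa [hN, Nat.mul_div_cancel M hq.pos] at h
  exact h W M q hq hcop hNW P hmin

/-! ## E2 — E1 with the crux's own slack (the weakest Takahashi-shaped leaf for THIS crux) -/

/-- **E2 (extremal slack).** `δ(W⋆) ≤ C(ε) · N^ε · ξ(M, q)(a(W⋆)) · ord_q Δ_min(W⋆)` at Frey pivots: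
Takahashi's inequality with a sub-polynomial defect.  Through `deg_le_of_optimalIsogenyAt` the crux
follows from E2 with constant `4 R(ε/3)² C(ε/3)` (memo §3), so E2 is the weakest statement of this
shape that still closes `DefiniteRTControlPrime` by the in-tree chain; in print the defect is
`1/i_q² ≤ 1` (Takahashi p. 80: `δ c_q = j_q² h_q`). [cite: Takahashi2001, Thm. 2.3 (p. 79–80)] -/
def TakahashiDefectSubpolyFrey : Prop :=
  ∀ ε : ℝ, 0 < ε → ∃ C : ℝ, ∀ (a b : ℤ), IsCoprime a b → a * b * (a + b) ≠ 0 →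
    ∀ (M q : ℕ) [NeZero (M * q)],
    (freyCurve a b).conductorNorm ℤ = M * q → q.Prime → q ≠ 2 →
    ∀ (W : WeierstrassCurve ℚ) [W.IsElliptic], W.conductorNorm ℤ = M * q →
      (freyCurve a b).IsIsogenous W →
      ∀ P : ModularParametrizationData W (M * q),
        (∀ (W' : WeierstrassCurve ℚ) [W'.IsElliptic], W'.conductorNorm ℤ = M * q →
            ∀ P' : ModularParametrizationData W' (M * q),
            P'.f = P.f → P.modularDegree ≤ P'.modularDegree) →
        (P.modularDegree : ℝ) ≤ C * ((M * q : ℕ) : ℝ) ^ ε *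
          ((brandtXi M q (fun n => W.LFunction n) : ℝ) *
            (((W.minimalDiscriminantNorm ℤ).factorization q : ℕ) : ℝ))

/-- E1 ⇒ E2 with `C = 1` (insert the idle factor `N^ε ≥ 1`). -/
theorem defectSubpolyFrey_of_degreeLeFreyPivot (h : TakahashiDegreeLeFreyPivot) :
    TakahashiDefectSubpolyFrey := by
  intro ε hε
  refine ⟨1, ?_⟩
  intro a b hab h0 M q _ hN hq hq2 W _ hNW hiso P hmin
  have hle := h a b hab h0 M q hN hq hq2 W hNW hiso P hmin
  have hcast : (P.modularDegree : ℝ) ≤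
      (brandtXi M q (fun n => W.LFunction n) : ℝ) *
        (((W.minimalDiscriminantNorm ℤ).factorization q : ℕ) : ℝ) := by
    exact_mod_cast hle
  have hN1 : (1 : ℝ) ≤ ((M * q : ℕ) : ℝ) := by
    exact_mod_cast Nat.one_le_iff_ne_zero.mpr (NeZero.ne (M * q))
  have hrpow : (1 : ℝ) ≤ ((M * q : ℕ) : ℝ) ^ ε := Real.one_le_rpow hN1 hε.le
  have hξv : (0 : ℝ) ≤ (brandtXi M q (fun n => W.LFunction n) : ℝ) *
      (((W.minimalDiscriminantNorm ℤ).factorization q : ℕ) : ℝ) := by positivity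
  calc (P.modularDegree : ℝ)
      ≤ (brandtXi M q (fun n => W.LFunction n) : ℝ) *
          (((W.minimalDiscriminantNorm ℤ).factorization q : ℕ) : ℝ) := hcast
    _ = 1 * 1 * ((brandtXi M q (fun n => W.LFunction n) : ℝ) *
          (((W.minimalDiscriminantNorm ℤ).factorization q : ℕ) : ℝ)) := by ring
    _ ≤ 1 * ((M * q : ℕ) : ℝ) ^ ε * ((brandtXi M q (fun n => W.LFunction n) : ℝ) *
          (((W.minimalDiscriminantNorm ℤ).factorization q : ℕ) : ℝ)) := by gcongr

/-- The chain stub ⇒ N1 ⇒ E1 ⇒ E2 in one line (every leaf of the lattice is implied by the stub). -/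
theorem defectSubpolyFrey_of_fact (h : takahashi2001_thm_2_3_of_coprime) :
    TakahashiDefectSubpolyFrey :=
  defectSubpolyFrey_of_degreeLeFreyPivot (degreeLeFreyPivot_of_degreeLe (degreeLe_of_fact h))

/-! ## G — the re-glue through E2 (statement only; ONE prover cycle after k2-g11's files land) -/

/-- **G.** `DefiniteRTControlPrime` from E2 alone.  Proof recipe (not executed here — stub-ideation
does not prove, and `Cruxes/` modules are not importable): in k2-g11's `deg_le_of_optimalIsogenyAt`
replace the binder `(hT : takahashi2001_thm_2_3_of_coprime)` by the pointwise E2 inequality at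
`(W⋆, P⋆)` (l.1697) and carry the real factor `C(ε/3) N^(ε/3)` through the `ℕ`-chain cast to `ℝ`
exactly as `definiteRTControlPrime_of_optimalRadiusSubpoly` already does for `B = ⌊R N^(ε/3)⌋₊`;
final constant `4 · R(ε/3)² · C(ε/3)`. -/
def CruxOfDefectSubpolyFrey : Prop :=
  TakahashiDefectSubpolyFrey → Summit.ABC.ABC.Theses.DefiniteXi.DefiniteRTControlPrime

/-- Sanity: the registered stub's type and the crux decl, by name. -/
example : takahashi2001_thm_2_3_of_coprime → TakahashiDegreeLeOfCoprime := degreeLe_of_fact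
#check (Summit.ABC.ABC.Theses.DefiniteXi.DefiniteRTControlPrime : Prop)

end Summit.ABC.ABC.Cruxes.DefiniteRTControlPrime.StubIdeas3G15
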